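import Summits.QuantumFields.BalabanUV.Beta.EriceRemainderEnclosureHistoryFadingContinuum

/-!
# EriceRemainderEnclosureHistoryFadingColumn — (E36d) THE SIGN-FREE ROAD: on node U2's own (box-uniform, sign-free) booking the fading
# constant enters the RATIO only, too — a small TILTED COLUMN budget `Σ_{l≥i} Λ l i·κ^{i−l} ≤ M^κ` with `2·U·M^κ ≤ 1` gives
# `disc_j ≤ (2c∕(1−θ))·κ^j` WITHOUT any monotonicity of the runs; `FadingMemory C θ Λ` (ANY `C`) + a k-uniform COLUMN total weight `M′`
# ((E32c)'s currency) supply it at ONE ratio `κ(θ, C∕M′, 4M′U) < 1`; hence node U2's `continuumRunning_of_runs_eventual` binder list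
# VERBATIM (no sign) with its smallness `C·U ≤ (1−θ)∕2` REPLACED by `4·M′·U < 1` gives `InjectedRate (2c∕(1−θ)) 0 κ` and `ContinuumRunning`

Cell `pub-balaban`, β-function sub-cell, BINDER row D4 «RemainderConst leaves for Bałaban's split» (`HOME/BINDER-OWNERS.md`; owner
lineage `b2b-balaban-beta-an4`; this file by co-owner #2 lineage `b2b-balaban-beta-d4-p2`, generation 38), β-FLOW TEAM duty (1),
FREEZE (0) honoured (def-free; no new leaf, no new hypothesis shape — the tilted column budget is an INLINE hypothesis on node U2's `Λ`).
Companion of (E36a) `EriceRemainderEnclosureHistoryFading` (the ROW road: near-monotone runs, rows `≤ M`) and (E36b)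
`EriceRemainderEnclosureHistoryFadingContinuum` (`exists_ratio`; node U2's `InjectedRate` and `T4ContinuumCoupling.ContinuumRunning` BY
NAME); over node U2's `T4CouplingMatching` (`disc_step`, `backward_sum`, `sum_weights_le_of_eventualLower` BY NAME).

HONEST FRAMING (page 1, verbatim and binding).  *"Discharging BetaPertH makes Bałaban's UV stability UNCONDITIONAL — a real
constructive-QFT result; it is NOT the continuum limit and NOT the Clay problem."*  THIS FILE DISCHARGES NOTHING OF THE KIND.  It is
elementary real analysis on node U2's typed HYPOTHESIS SHAPES over an ABSTRACT family `β : FlowStep.HBeta` (`ScaleShiftRate`,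
`HistLipschitz`, `FadingMemory` — NOT PRINTED, GAPS G-t4-U2-1∕-2; the floor shape of (0.31)) — NONE asserted for [I] (1.22); nothing of
Bałaban's is quoted newly (loci verbatim in the headers of `FlowStep` ∕ `T4CouplingMatching` ∕ `T4ContinuumCoupling`).  Row D4 class
UNCHANGED (critical-path width 0; instance 0∕1; D4 DISCHARGE NO DATE).  HONEST DEPENDENCY: continuum YM on T⁴ ⇐ BetaPertH ∧ nine spine
estimates (0/9 proved); BetaPertH ⇐ (D1) ∧ (D4) ∧ CAP+tail; G-an2-4 gates asym, D1 and NE2/3/4.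

THE POINT (census sense (α)).  (E36a)'s kernel pays each row at the INFLUENCED scale, which needs the runs to be near-monotone (the
sign, or the eventual floor + a two-sided bound).  Node U2's own closure `twoSided_fixedPoint` ∕ `disc_le_of_fadingMemory` is SIGN-FREE: it
pays the influencing scale `i` with its own weight `u_i` and sums the rows geometrically — which is where its smallness ON THE FADING
CONSTANT comes from.  The sign-free road without that smallness: swap the order of summation (rows `l ≥ j`, then influencing scales
`i`), so that the weight `u_i` meets the TILTED COLUMN `Σ_{l ≥ i} Λ l i·κ^{i−l}` of the modulus (§1 `geom_of_expMomentCol`: `2·U·M^κ ≤ 1` ⟹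
`δ_j ≤ (2c∕(1−θ))·κ^j`, NO monotonicity) — the column analogue of (E36a)'s exponential age-moment, as (E32c)'s column total weight is
the sign-free analogue of (E32)'s rows.  Fading caps + a k-uniform COLUMN total weight `Σ_{l≥i} Λ l i ≤ M′` supply it (§1
`expMomentCol_of_fading`: `M^κ = (M′ + Cθ^{a+1}∕(κ−θ))∕κ^a`), so (§2) node U2's binder list VERBATIM — two pinned runs, `ScaleShiftRate c θ γ β`,
`HistLipschitz Λ γ β`, `FadingMemory C θ Λ`, `EventualLowerH b γ k₀ β` — with `C·U ≤ (1−θ)∕2` REPLACED by «columns `≤ M′`, `4·M′·U < 1`» gives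
node U2's output shape `InjectedRate (2c∕(1−θ)) 0 κ` at ONE `κ(θ, C∕M′, 4M′U) < 1` and `T4ContinuumCoupling.ContinuumRunning` BY NAME.
(`FadingMemory C θ Λ` alone gives columns `≤ C∕(1−θ)`; the point is a column budget `M′ ≪ C∕(1−θ)` — long, weak memory.)  NOT claimed:
anything about Bałaban's (1.22); uniformity of `κ` in `C` (refuted by (E36c)).

WHAT IS PROVED ([folklore]; 0 `def`, 0 sorry; nothing of [I] asserted).
 §1 **`geom_of_expMomentCol`** (sign-free kernel: `δ ≥ 0`, `δ_K = 0`, `u ≥ 0` with `Σ u ≤ U`, `Λ ≥ 0` with the tilted column budget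
    `Σ_{l∈[i,N)} Λ l i·κ^i∕κ^l ≤ M^κ`, node U2's recursion, `2·U·M^κ ≤ 1` ⟹ `δ_j ≤ (2c∕(1−θ))κ^j`), **`expMomentCol_of_fading`** (caps + columns
    `≤ M′` ⟹ `M^κ = (M′ + Cθ^{a+1}∕(κ−θ))∕κ^a`).
 §2 **`disc_le_geom_of_fading_col`** (node U2's binder list + columns, explicit `κ`, `a`), `disc_le_geom_of_fading_col_eventual`
    (`U = (k₀+1)γ³ + 2γ∕b`), **`geometric_uniform_fading_col`** (ONE `κ` before the class), **`injectedRate_of_fading_col`**,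
    **`continuumRunning_of_fading_col`** (node U2's `continuumRunning_of_runs_eventual` with the smallness moved off the fading constant).
-/

noncomputable section
open Finset

namespace Summit.QuantumFields.BalabanUV.Beta.EriceRemainderEnclosureHistoryFadingColumn

open Literature.MathematicalPhysics.QuantumFieldTheory.Balaban1983to89
open Literature.MathematicalPhysics.QuantumFieldTheory.Balaban1983to89.FlowStep
open Literature.MathematicalPhysics.QuantumFieldTheory.Balaban1983to89.T4CouplingMatching
open Literature.MathematicalPhysics.QuantumFieldTheory.Balaban1983to89.T4CauchySum (InjectedRate)
open Literature.MathematicalPhysics.QuantumFieldTheory.Balaban1983to89.T4ContinuumCoupling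
  (ContinuumRunning continuumRunning_of_injectedRate)
open Summit.QuantumFields.BalabanUV.Beta.EriceRemainderEnclosureHistoryFadingContinuum (exists_ratio)

/-! ## §1 The sign-free kernel: tilted COLUMN budget, no monotonicity -/

/-- **THE SIGN-FREE KERNEL — GEOMETRIC RATE FROM A SMALL TILTED COLUMN BUDGET.**  Let `0 ≤ θ < 1`, `θ ≤ κ ≤ 1`, `κ > 0`, `c ≥ 0`;
`δ ≥ 0` with the pin `δ_K = 0`; weights `u_i ≥ 0` (`i ≤ K`) with `Σ_{i≤K} u_i ≤ U` (NO monotonicity); moduli `Λ ≥ 0` with the κ-TILTED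
COLUMN BUDGET `Σ_{l∈[i,N)} Λ l i·(κ^i∕κ^l) ≤ M^κ` for all `i, N` (an exponential moment of the column above `i` in the age `l − i`); node
U2's recursion `δ_j ≤ δ_{j+1} + cθ^j + Σ_{i≤j} Λ j i·u_i·δ_i` (`j < K`); SMALLNESS `2·U·M^κ ≤ 1`.  THEN `δ_j ≤ (2c∕(1−θ))·κ^j` for every `j ≤ K`.
Proof: with `D = max_i δ_i∕κ^i`, after backward accumulation the double sum over rows `l ∈ [j, K)` and influencing scales `i ≤ l` is
swapped (`sum_comm'`); the weight `u_i` meets the tilted column of `Λ` above `i`, `κ^i ≤ (κ^i∕κ^l)·κ^j` for `l ≥ j`; so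
`δ_j∕κ^j ≤ c∕(1−θ) + U·M^κ·D`, absorbed at the maximiser.  Node U2's `twoSided_fixedPoint` is the case where the caps `Cθ^{l−i}` bound the
tilted entries by `C` and the rows are summed geometrically in `θ`. [folklore] -/
theorem geom_of_expMomentCol {K : ℕ} {δ u : ℕ → ℝ} {Λ : ℕ → ℕ → ℝ} {θ κ c Mκ U : ℝ}
    (hθ0 : 0 ≤ θ) (hθ1 : θ < 1) (hθκ : θ ≤ κ) (hκ0 : 0 < κ) (hκ1 : κ ≤ 1) (hc : 0 ≤ c)
    (hδ : ∀ j, 0 ≤ δ j) (hK : δ K = 0)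
    (hu : ∀ i, i ≤ K → 0 ≤ u i) (hU : ∑ i ∈ range (K + 1), u i ≤ U)
    (hΛ0 : ∀ l i, i ≤ l → 0 ≤ Λ l i)
    (hcol : ∀ i N, ∑ l ∈ Ico i N, Λ l i * (κ ^ i / κ ^ l) ≤ Mκ)
    (hrec : ∀ j, j < K → δ j ≤ δ (j + 1) + c * θ ^ j + ∑ i ∈ range (j + 1), Λ j i * u i * δ i)
    (hsmall : 2 * (U * Mκ) ≤ 1) :
    ∀ j, j ≤ K → δ j ≤ 2 * c / (1 - θ) * κ ^ j := by
  have hne : (range (K + 1)).Nonempty := ⟨0, by simp⟩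
  set D := (range (K + 1)).sup' hne (fun i => δ i / κ ^ i) with hD
  have hDi : ∀ i, i ≤ K → δ i ≤ D * κ ^ i := by
    intro i hi
    have h : δ i / κ ^ i ≤ D := le_sup' (fun i => δ i / κ ^ i) (mem_range.mpr (Nat.lt_succ_of_le hi))
    rwa [div_le_iff₀ (pow_pos hκ0 i)] at h
  have hD0 : 0 ≤ D := by
    have h : δ 0 / κ ^ 0 ≤ D := le_sup' (fun i => δ i / κ ^ i) (mem_range.mpr (Nat.succ_pos K))
    have : (0 : ℝ) ≤ δ 0 / κ ^ 0 := by simpa using hδ 0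
    exact this.trans h
  have hU0 : 0 ≤ U := (sum_nonneg fun i hi => hu i (Nat.lt_succ_iff.mp (mem_range.mp hi))).trans hU
  have hMκ0 : 0 ≤ Mκ := by
    have h := hcol 0 0
    simpa using h
  have h1θ : 0 < 1 - θ := by linarith
  -- backward accumulation with the raw feedback
  have hrec' : ∀ j, j < K → δ j ≤ δ (j + 1) + (c * θ ^ j + ∑ i ∈ range (j + 1), Λ j i * u i * δ i) := by
    intro j hj; linarith [hrec j hj]
  -- the double sum over rows l ∈ [j,K) and influencing scales i ≤ l, swapped onto the tilted columns
  have hdouble : ∀ j, j ≤ K →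
      ∑ l ∈ Ico j K, ∑ i ∈ range (l + 1), Λ l i * u i * δ i ≤ D * Mκ * U * κ ^ j := by
    intro j hj
    have hswap : ∑ l ∈ Ico j K, ∑ i ∈ range (l + 1), Λ l i * u i * δ i
        = ∑ i ∈ range K, ∑ l ∈ Ico (max i j) K, Λ l i * u i * δ i := by
      refine sum_comm' (fun l i => ?_)
      simp only [mem_Ico, mem_range, max_le_iff]
      omega
    rw [hswap]
    have hinner : ∀ i ∈ range K, ∑ l ∈ Ico (max i j) K, Λ l i * u i * δ i ≤ u i * (D * Mκ * κ ^ j) := by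
      intro i hi
      have hiK : i ≤ K := (mem_range.mp hi).le
      have hui := hu i hiK
      calc ∑ l ∈ Ico (max i j) K, Λ l i * u i * δ i
          ≤ ∑ l ∈ Ico (max i j) K, Λ l i * u i * (D * κ ^ i) := by
            refine sum_le_sum fun l hl => ?_
            have hil : i ≤ l := le_of_max_le_left (mem_Ico.mp hl).1
            exact mul_le_mul_of_nonneg_left (hDi i hiK) (mul_nonneg (hΛ0 l i hil) hui)
        _ = u i * D * ∑ l ∈ Ico (max i j) K, Λ l i * κ ^ i := by
            rw [mul_sum]; exact sum_congr rfl fun l _ => by ring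
        _ ≤ u i * D * ∑ l ∈ Ico (max i j) K, Λ l i * (κ ^ i / κ ^ l) * κ ^ j := by
            refine mul_le_mul_of_nonneg_left (sum_le_sum fun l hl => ?_) (mul_nonneg hui hD0)
            have hl' := mem_Ico.mp hl
            have hil : i ≤ l := le_of_max_le_left hl'.1
            have hjl : j ≤ l := le_of_max_le_right hl'.1
            have hκl : 0 < κ ^ l := pow_pos hκ0 l
            have hk : κ ^ i ≤ κ ^ i / κ ^ l * κ ^ j := by
              rw [div_mul_eq_mul_div, le_div_iff₀ hκl]
              exact mul_le_mul_of_nonneg_left (pow_le_pow_of_le_one hκ0.le hκ1 hjl) (pow_nonneg hκ0.le _)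
            calc Λ l i * κ ^ i ≤ Λ l i * (κ ^ i / κ ^ l * κ ^ j) := mul_le_mul_of_nonneg_left hk (hΛ0 l i hil)
              _ = Λ l i * (κ ^ i / κ ^ l) * κ ^ j := by ring
        _ = u i * D * κ ^ j * ∑ l ∈ Ico (max i j) K, Λ l i * (κ ^ i / κ ^ l) := by
            rw [← sum_mul]; ring
        _ ≤ u i * D * κ ^ j * ∑ l ∈ Ico i K, Λ l i * (κ ^ i / κ ^ l) := by
            refine mul_le_mul_of_nonneg_left ?_ (by positivity)
            refine sum_le_sum_of_subset_of_nonneg (Ico_subset_Ico (le_max_left _ _) le_rfl) fun l hl _ => ?_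
            exact mul_nonneg (hΛ0 l i (mem_Ico.mp hl).1) (by positivity)
        _ ≤ u i * D * κ ^ j * Mκ := mul_le_mul_of_nonneg_left (hcol i K) (by positivity)
        _ = u i * (D * Mκ * κ ^ j) := by ring
    calc ∑ i ∈ range K, ∑ l ∈ Ico (max i j) K, Λ l i * u i * δ i
        ≤ ∑ i ∈ range K, u i * (D * Mκ * κ ^ j) := sum_le_sum hinner
      _ = (∑ i ∈ range K, u i) * (D * Mκ * κ ^ j) := by rw [sum_mul]
      _ ≤ U * (D * Mκ * κ ^ j) := by
          refine mul_le_mul_of_nonneg_right ?_ (by positivity)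
          calc ∑ i ∈ range K, u i ≤ ∑ i ∈ range (K + 1), u i :=
                sum_le_sum_of_subset_of_nonneg (range_mono (Nat.le_succ K))
                  (fun i hi _ => hu i (Nat.lt_succ_iff.mp (mem_range.mp hi)))
            _ ≤ U := hU
      _ = D * Mκ * U * κ ^ j := by ring
  have hbound : ∀ j, j ≤ K → δ j ≤ (c / (1 - θ) + D * Mκ * U) * κ ^ j := by
    intro j hj
    have hb := backward_sum (le_of_eq hK) hrec' j hj
    have hgeo : ∑ i ∈ Ico j K, θ ^ i ≤ θ ^ j / (1 - θ) := geom_sum_Ico_le_of_lt_one hθ0 hθ1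
    have hθκj : θ ^ j ≤ κ ^ j := pow_le_pow_left₀ hθ0 hθκ j
    calc δ j ≤ ∑ l ∈ Ico j K, (c * θ ^ l + ∑ i ∈ range (l + 1), Λ l i * u i * δ i) := hb
      _ = c * ∑ l ∈ Ico j K, θ ^ l + ∑ l ∈ Ico j K, ∑ i ∈ range (l + 1), Λ l i * u i * δ i := by
          rw [sum_add_distrib, mul_sum]
      _ ≤ c * (θ ^ j / (1 - θ)) + D * Mκ * U * κ ^ j :=
          add_le_add (mul_le_mul_of_nonneg_left hgeo hc) (hdouble j hj)
      _ = c / (1 - θ) * θ ^ j + D * Mκ * U * κ ^ j := by ring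
      _ ≤ c / (1 - θ) * κ ^ j + D * Mκ * U * κ ^ j :=
          add_le_add (mul_le_mul_of_nonneg_left hθκj (div_nonneg hc h1θ.le)) le_rfl
      _ = (c / (1 - θ) + D * Mκ * U) * κ ^ j := by ring
  obtain ⟨i₀, hi₀, hDi₀⟩ := exists_mem_eq_sup' hne (fun i => δ i / κ ^ i)
  have hi₀K : i₀ ≤ K := Nat.lt_succ_iff.mp (mem_range.mp hi₀)
  have hDle : D ≤ c / (1 - θ) + D * Mκ * U := by
    calc D = δ i₀ / κ ^ i₀ := hDi₀
      _ ≤ c / (1 - θ) + D * Mκ * U := by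
          rw [div_le_iff₀ (pow_pos hκ0 i₀)]
          exact hbound i₀ hi₀K
  have hhalf : U * Mκ ≤ 1 / 2 := by linarith
  have hDfin : D ≤ 2 * c / (1 - θ) := by
    have h1 : D * Mκ * U ≤ D * (1 / 2) := by
      have := mul_le_mul_of_nonneg_left hhalf hD0
      linarith [show D * Mκ * U = D * (U * Mκ) by ring]
    have h2 : D ≤ 2 * (c / (1 - θ)) := by linarith
    calc D ≤ 2 * (c / (1 - θ)) := h2
      _ = 2 * c / (1 - θ) := by ring
  intro j hj
  calc δ j ≤ D * κ ^ j := hDi j hj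
    _ ≤ 2 * c / (1 - θ) * κ ^ j := mul_le_mul_of_nonneg_right hDfin (pow_nonneg hκ0.le _)

/-- **SUPPLIER — FADING CAPS PLUS A COLUMN BUDGET GIVE EVERY TILTED COLUMN BUDGET AT RATES `1∕κ < 1∕θ`.**  If `0 ≤ Λ l i ≤ C·θ^{l−i}`
(`i ≤ l`; ANY `C`) and the COLUMN total weight `Σ_{l∈[i,N)} Λ l i ≤ M′` for all `N` ((E32c)'s currency), then for every window `a` and
`θ < κ ≤ 1`: `Σ_{l∈[i,N)} Λ l i·(κ^i∕κ^l) ≤ (M′ + C·θ^{a+1}∕(κ−θ))∕κ^a` — ages `≤ a` through the column budget (`κ^i∕κ^l ≤ 1∕κ^a`), older ages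
through the caps (`Σ_{n>a} C(θ∕κ)^n`). [folklore] -/
theorem expMomentCol_of_fading {Λ : ℕ → ℕ → ℝ} {θ κ C M' : ℝ} (a : ℕ) {i N : ℕ}
    (hθ0 : 0 ≤ θ) (hθκ : θ < κ) (hκ1 : κ ≤ 1)
    (hΛ0 : ∀ l, i ≤ l → 0 ≤ Λ l i) (hfade : ∀ l, i ≤ l → Λ l i ≤ C * θ ^ (l - i))
    (hcolM : ∑ l ∈ Ico i N, Λ l i ≤ M') (hC : 0 ≤ C) :
    ∑ l ∈ Ico i N, Λ l i * (κ ^ i / κ ^ l) ≤ (M' + C * θ ^ (a + 1) / (κ - θ)) / κ ^ a := by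
  have hκ0 : 0 < κ := lt_of_le_of_lt hθ0 hθκ
  have hκne : κ ≠ 0 := hκ0.ne'
  have hκa : 0 < κ ^ a := pow_pos hκ0 a
  have hκθ : 0 < κ - θ := by linarith
  have hκθne : κ - θ ≠ 0 := hκθ.ne'
  have hr0 : 0 ≤ θ / κ := div_nonneg hθ0 hκ0.le
  have hr1 : θ / κ < 1 := (div_lt_one hκ0).mpr hθκ
  obtain ⟨g, hg⟩ : ∃ g : ℕ → ℝ, ∀ n, g n = if a + 1 ≤ n then (θ / κ) ^ n else 0 := ⟨_, fun _ => rfl⟩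
  have hg0 : ∀ n, 0 ≤ g n := fun n => by rw [hg]; split_ifs <;> positivity
  have hterm : ∀ l ∈ Ico i N, Λ l i * (κ ^ i / κ ^ l) ≤ Λ l i * (1 / κ ^ a) + C * g (l - i) := by
    intro l hl
    have hil : i ≤ l := (mem_Ico.mp hl).1
    have hκl : 0 < κ ^ l := pow_pos hκ0 l
    by_cases h : a + 1 ≤ l - i
    · have hgi : g (l - i) = (θ / κ) ^ (l - i) := by rw [hg, if_pos h]
      have e : θ ^ (l - i) * (κ ^ i / κ ^ l) = (θ / κ) ^ (l - i) := by
        rw [div_pow, ← pow_sub_mul_pow κ hil]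
        field_simp
      calc Λ l i * (κ ^ i / κ ^ l) ≤ C * θ ^ (l - i) * (κ ^ i / κ ^ l) :=
            mul_le_mul_of_nonneg_right (hfade l hil) (by positivity)
        _ = C * g (l - i) := by rw [hgi, mul_assoc, e]
        _ ≤ Λ l i * (1 / κ ^ a) + C * g (l - i) := le_add_of_nonneg_left (mul_nonneg (hΛ0 l hil) (by positivity))
    · have hgz : g (l - i) = 0 := by rw [hg, if_neg h]
      have hk : κ ^ i / κ ^ l ≤ 1 / κ ^ a := by
        rw [div_le_div_iff₀ hκl hκa, one_mul, ← pow_add]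
        exact pow_le_pow_of_le_one hκ0.le hκ1 (by omega)
      calc Λ l i * (κ ^ i / κ ^ l) ≤ Λ l i * (1 / κ ^ a) := mul_le_mul_of_nonneg_left hk (hΛ0 l hil)
        _ = Λ l i * (1 / κ ^ a) + C * g (l - i) := by rw [hgz, mul_zero, add_zero]
  have hgsum : ∑ l ∈ Ico i N, g (l - i) ≤ (θ / κ) ^ (a + 1) / (1 - θ / κ) := by
    rw [sum_Ico_eq_sum_range (fun l => g (l - i)) i N]
    have hre : ∑ n ∈ range (N - i), g (i + n - i) = ∑ n ∈ range (N - i), g n :=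
      sum_congr rfl fun n _ => by rw [Nat.add_sub_cancel_left]
    rw [hre]
    have hfil : ∑ n ∈ range (N - i), g n = ∑ n ∈ (range (N - i)).filter (fun n => a + 1 ≤ n), (θ / κ) ^ n := by
      rw [sum_filter]
      exact sum_congr rfl fun n _ => hg n
    rw [hfil]
    calc ∑ n ∈ (range (N - i)).filter (fun n => a + 1 ≤ n), (θ / κ) ^ n
        ≤ ∑ n ∈ Ico (a + 1) (N - i), (θ / κ) ^ n := by
          refine sum_le_sum_of_subset_of_nonneg ?_ (fun n _ _ => pow_nonneg hr0 n)
          intro n hn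
          simp only [mem_filter, mem_range] at hn
          exact mem_Ico.mpr ⟨hn.2, hn.1⟩
      _ ≤ (θ / κ) ^ (a + 1) / (1 - θ / κ) := geom_sum_Ico_le_of_lt_one hr0 hr1
  have htail : (θ / κ) ^ (a + 1) / (1 - θ / κ) = θ ^ (a + 1) / (κ ^ a * (κ - θ)) := by
    have h1 : 1 - θ / κ = (κ - θ) / κ := by field_simp
    rw [h1, div_pow, pow_succ κ a]
    field_simp
  calc ∑ l ∈ Ico i N, Λ l i * (κ ^ i / κ ^ l)
      ≤ ∑ l ∈ Ico i N, (Λ l i * (1 / κ ^ a) + C * g (l - i)) := sum_le_sum hterm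
    _ = (∑ l ∈ Ico i N, Λ l i) * (1 / κ ^ a) + C * ∑ l ∈ Ico i N, g (l - i) := by
        rw [sum_add_distrib, sum_mul, mul_sum]
    _ ≤ M' * (1 / κ ^ a) + C * (θ ^ (a + 1) / (κ ^ a * (κ - θ))) := by
        refine add_le_add (mul_le_mul_of_nonneg_right hcolM (by positivity)) ?_
        rw [← htail]
        exact mul_le_mul_of_nonneg_left hgsum hC
    _ = (M' + C * θ ^ (a + 1) / (κ - θ)) / κ ^ a := by
        field_simp

/-! ## §2 Run level on node U2's own road: its binder list verbatim, the smallness moved off the fading constant -/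

/-- **TWO PINNED RUNS, SIGN-FREE — FADING MEMORY WITH AN ARBITRARY CONSTANT PLUS A COLUMN BUDGET.**  Node U2's binder list of
`disc_le_of_fadingMemory` VERBATIM — two runs of (0.20) (A: `K` steps, B: `K + 1` steps) in ]0,γ], pinned `g^A_K = g^B_{K+1}`,
`ScaleShiftRate c θ γ β` (`c ≥ 0`, `0 ≤ θ`), `HistLipschitz Λ γ β`, `FadingMemory C θ Λ` (ANY `C`), the AF weight bound
`Σ_{i≤K} (g^A_i)²g^B_{i+1} ≤ U` — with its smallness `C·U ≤ (1−θ)∕2` REPLACED by: a k-uniform COLUMN total weight `Σ_{l∈[i,N)} Λ l i ≤ M′`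
and, for a window `a` and a ratio `θ < κ ≤ 1`, `2·U·(M′ + C·θ^{a+1}∕(κ−θ)) ≤ κ^a`.  THEN `disc gA gB j ≤ (2c∕(1−θ))·κ^j` for every `j ≤ K`.  NO
sign, NO monotonicity of the runs. [cite: Balaban1987RG1, (0.20) p.256 and §5 p.298] -/
theorem disc_le_geom_of_fading_col {β : HBeta} {γ c θ κ C M' U : ℝ} {Λ : ℕ → ℕ → ℝ} {K a : ℕ} {gA gB : ℕ → ℝ}
    (hc : 0 ≤ c) (hθ0 : 0 ≤ θ) (hθκ : θ < κ) (hκ1 : κ ≤ 1) (hC : 0 ≤ C)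
    (hA : RGEqH K β gA) (hB : RGEqH (K + 1) β gB)
    (hAbox : ∀ i, i ≤ K → 0 < gA i ∧ gA i ≤ γ) (hBbox : ∀ i, i ≤ K + 1 → 0 < gB i ∧ gB i ≤ γ)
    (hpin : gA K = gB (K + 1))
    (hS : ScaleShiftRate c θ γ β) (hL : HistLipschitz Λ γ β) (hF : FadingMemory C θ Λ)
    (hcolM : ∀ i N, ∑ l ∈ Ico i N, Λ l i ≤ M')
    (hU : ∑ i ∈ range (K + 1), (gA i) ^ 2 * gB (i + 1) ≤ U)
    (hsmall : 2 * (U * (M' + C * θ ^ (a + 1) / (κ - θ))) ≤ κ ^ a) :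
    ∀ j, j ≤ K → disc gA gB j ≤ 2 * c / (1 - θ) * κ ^ j := by
  have hκ0 : 0 < κ := lt_of_le_of_lt hθ0 hθκ
  have hθ1 : θ < 1 := lt_of_lt_of_le hθκ hκ1
  have hκa : 0 < κ ^ a := pow_pos hκ0 a
  have hΛ : ∀ k i, i ≤ k → 0 ≤ Λ k i := fun k i hik => (hF k i hik).1
  have hcol : ∀ i N, ∑ l ∈ Ico i N, Λ l i * (κ ^ i / κ ^ l) ≤ (M' + C * θ ^ (a + 1) / (κ - θ)) / κ ^ a :=
    fun i N => expMomentCol_of_fading a hθ0 hθκ hκ1 (fun l hl => (hF l i hl).1) (fun l hl => (hF l i hl).2) (hcolM i N) hC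
  have hu : ∀ i, i ≤ K → 0 ≤ (gA i) ^ 2 * gB (i + 1) := fun i hi =>
    mul_nonneg (sq_nonneg _) (hBbox (i + 1) (by omega)).1.le
  have hsmall' : 2 * (U * ((M' + C * θ ^ (a + 1) / (κ - θ)) / κ ^ a)) ≤ 1 := by
    rw [show 2 * (U * ((M' + C * θ ^ (a + 1) / (κ - θ)) / κ ^ a)) = 2 * (U * (M' + C * θ ^ (a + 1) / (κ - θ))) / κ ^ a by ring]
    rwa [div_le_one hκa]
  refine geom_of_expMomentCol (u := fun i => (gA i) ^ 2 * gB (i + 1)) hθ0 hθ1 hθκ.le hκ0 hκ1 hc (disc_nonneg gA gB)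
    (disc_pin hpin) hu hU hΛ hcol ?_ hsmall'
  intro j hj
  exact disc_step hA hB hAbox hBbox hS hL hΛ hj

/-- **EVENTUAL-AF FORM** (`U = (k₀+1)γ³ + 2γ∕b` from `EventualLowerH b γ k₀ β`, `b > 0`, node U2's `sum_weights_le_of_eventualLower` BY NAME;
NO sign): smallness `2·((k₀+1)γ³ + 2γ∕b)·(M′ + C·θ^{a+1}∕(κ−θ)) ≤ κ^a` ⟹ `disc gA gB j ≤ (2c∕(1−θ))·κ^j` for every `j ≤ K`.
[cite: Balaban1987RG1, (0.20) p.256 and (0.31) p.259] -/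
theorem disc_le_geom_of_fading_col_eventual {β : HBeta} {γ b c θ κ C M' : ℝ} {k₀ a : ℕ} {Λ : ℕ → ℕ → ℝ} {K : ℕ}
    {gA gB : ℕ → ℝ}
    (hγ : 0 < γ) (hb : 0 < b) (hc : 0 ≤ c) (hθ0 : 0 ≤ θ) (hθκ : θ < κ) (hκ1 : κ ≤ 1) (hC : 0 ≤ C)
    (hA : RGEqH K β gA) (hB : RGEqH (K + 1) β gB)
    (hAbox : ∀ i, i ≤ K → 0 < gA i ∧ gA i ≤ γ) (hBbox : ∀ i, i ≤ K + 1 → 0 < gB i ∧ gB i ≤ γ)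
    (hpin : gA K = gB (K + 1))
    (hS : ScaleShiftRate c θ γ β) (hL : HistLipschitz Λ γ β) (hF : FadingMemory C θ Λ)
    (hcolM : ∀ i N, ∑ l ∈ Ico i N, Λ l i ≤ M') (hlo : EventualLowerH b γ k₀ β)
    (hsmall : 2 * ((((k₀ : ℝ) + 1) * γ ^ 3 + 2 * γ / b) * (M' + C * θ ^ (a + 1) / (κ - θ))) ≤ κ ^ a) :
    ∀ j, j ≤ K → disc gA gB j ≤ 2 * c / (1 - θ) * κ ^ j :=
  disc_le_geom_of_fading_col hc hθ0 hθκ hκ1 hC hA hB hAbox hBbox hpin hS hL hF hcolM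
    (sum_weights_le_of_eventualLower hγ hb hA hB hAbox hBbox hlo) hsmall

/-- **ONE RATIO BEFORE THE CLASS (sign-free).**  For `c ≥ 0`, `0 ≤ θ < 1`, box `γ > 0`, floor `b > 0`, ANY fading constant `C ≥ 0` and a
column budget `M′ > 0` with `4·M′·((k₀+1)γ³ + 2γ∕b) < 1`, there is ONE `θ < κ < 1` such that for EVERY `β`, `Λ`, `K`, pinned runs
`gA` ∕ `gB` of (0.20) in ]0,γ] with `ScaleShiftRate c θ γ β`, `HistLipschitz Λ γ β`, `FadingMemory C θ Λ`, columns `≤ M′`, `EventualLowerH b γ k₀ β`: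
`disc gA gB j ≤ (2c∕(1−θ))·κ^j` for all `j ≤ K` ((E36b) `exists_ratio` with `q = 4M′U`). [cite: Balaban1987RG1, (0.20) p.256 and (0.31) p.259] -/
theorem geometric_uniform_fading_col {c θ γ b C M' : ℝ} {k₀ : ℕ} (hc : 0 ≤ c) (hθ0 : 0 ≤ θ) (hθ1 : θ < 1)
    (hγ : 0 < γ) (hb : 0 < b) (hC : 0 ≤ C) (hM' : 0 < M')
    (hsmall : 4 * (M' * (((k₀ : ℝ) + 1) * γ ^ 3 + 2 * γ / b)) < 1) :
    ∃ κ : ℝ, θ < κ ∧ κ < 1 ∧ ∀ (β : HBeta) (Λ : ℕ → ℕ → ℝ) (K : ℕ) (gA gB : ℕ → ℝ),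
      RGEqH K β gA → RGEqH (K + 1) β gB →
      (∀ i, i ≤ K → 0 < gA i ∧ gA i ≤ γ) → (∀ i, i ≤ K + 1 → 0 < gB i ∧ gB i ≤ γ) → gA K = gB (K + 1) →
      ScaleShiftRate c θ γ β → HistLipschitz Λ γ β → FadingMemory C θ Λ →
      (∀ i N, ∑ l ∈ Ico i N, Λ l i ≤ M') → EventualLowerH b γ k₀ β →
      ∀ j, j ≤ K → disc gA gB j ≤ 2 * c / (1 - θ) * κ ^ j := by
  have hU0 : 0 < ((k₀ : ℝ) + 1) * γ ^ 3 + 2 * γ / b := by positivity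
  obtain ⟨κ, a, hθκ, hκ1, hqκ, hwin⟩ :=
    exists_ratio (q := 4 * (M' * (((k₀ : ℝ) + 1) * γ ^ 3 + 2 * γ / b))) hθ0 hθ1 hC hM' (by positivity) hsmall
  refine ⟨κ, hθκ, hκ1, fun β Λ K gA gB hA hB hAbox hBbox hpin hS hL hF hcolM hlo => ?_⟩
  refine disc_le_geom_of_fading_col_eventual (a := a) hγ hb hc hθ0 hθκ hκ1.le hC hA hB hAbox hBbox hpin hS hL hF hcolM hlo ?_
  calc 2 * ((((k₀ : ℝ) + 1) * γ ^ 3 + 2 * γ / b) * (M' + C * θ ^ (a + 1) / (κ - θ)))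
      ≤ 2 * ((((k₀ : ℝ) + 1) * γ ^ 3 + 2 * γ / b) * (M' + M')) := by
        have h := add_le_add_left hwin M'
        nlinarith [hU0.le]
    _ = 4 * (M' * (((k₀ : ℝ) + 1) * γ ^ 3 + 2 * γ / b)) := by ring
    _ ≤ κ ^ a := hqκ

/-- **NODE U2'S OUTPUT SHAPE ON ITS OWN ROAD, FADING CONSTANT FREE.**  Node U2's `injectedRate_of_runs_eventual` binder list VERBATIM — a
family of pinned runs `g` of (0.20) in ]0,γ] (`g K K = g_IR`), `ScaleShiftRate c θ γ β`, `HistLipschitz Λ γ β`, `FadingMemory C θ Λ`,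
`EventualLowerH b γ k₀ β` (`b > 0`) — with its smallness `C·((k₀+1)γ³ + 2γ∕b) ≤ (1−θ)∕2` REPLACED by a column budget `M′ > 0` with
`4·M′·((k₀+1)γ³ + 2γ∕b) < 1` (ANY `C ≥ 0`): there is `θ < κ < 1` with `T4CauchySum.InjectedRate (2c∕(1−θ)) 0 κ (fun K j ↦ disc (g K) (g (K+1)) j)`.
[cite: Balaban1987RG1, (0.20) p.256 and Thm 2 p.259] -/
theorem injectedRate_of_fading_col {β : HBeta} {γ b c θ C M' : ℝ} {k₀ : ℕ} {Λ : ℕ → ℕ → ℝ} (g : ℕ → ℕ → ℝ) (gIR : ℝ)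
    (hγ : 0 < γ) (hb : 0 < b) (hθ0 : 0 ≤ θ) (hθ1 : θ < 1) (hc : 0 ≤ c) (hC : 0 ≤ C) (hM' : 0 < M')
    (hrun : ∀ K, RGEqH K β (g K)) (hbox : ∀ K i, i ≤ K → 0 < g K i ∧ g K i ≤ γ) (hpin : ∀ K, g K K = gIR)
    (hS : ScaleShiftRate c θ γ β) (hL : HistLipschitz Λ γ β) (hF : FadingMemory C θ Λ)
    (hcolM : ∀ i N, ∑ l ∈ Ico i N, Λ l i ≤ M') (hlo : EventualLowerH b γ k₀ β)
    (hsmall : 4 * (M' * (((k₀ : ℝ) + 1) * γ ^ 3 + 2 * γ / b)) < 1) :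
    ∃ κ : ℝ, θ < κ ∧ κ < 1 ∧ InjectedRate (2 * c / (1 - θ)) 0 κ (fun K j => disc (g K) (g (K + 1)) j) := by
  obtain ⟨κ, hθκ, hκ1, h⟩ := geometric_uniform_fading_col hc hθ0 hθ1 hγ hb hC hM' hsmall
  refine ⟨κ, hθκ, hκ1, fun K j hj => ⟨disc_nonneg _ _ _, ?_⟩⟩
  have h' := h β Λ K (g K) (g (K + 1)) (hrun K) (hrun (K + 1)) (hbox K) (hbox (K + 1))
    ((hpin K).trans (hpin (K + 1)).symm) hS hL hF hcolM hlo j hj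
  simpa using h'

/-- **THE CONTINUUM RUNNING COUPLING ON NODE U2'S OWN ROAD, FADING CONSTANT FREE (`T4ContinuumCoupling` BY NAME).**  Node U2's
`continuumRunning_of_runs_eventual` with the smallness `C·((k₀+1)γ³ + 2γ∕b) ≤ (1−θ)∕2` on the fading constant REPLACED by a k-uniform
column budget `M′` with `4·M′·((k₀+1)γ³ + 2γ∕b) < 1`, the fading constant `C ≥ 0` ARBITRARY: `T4ContinuumCoupling.ContinuumRunning β g g_IR γ b`.
[folklore] -/
theorem continuumRunning_of_fading_col {β : HBeta} {γ b c θ C M' : ℝ} {k₀ : ℕ} {Λ : ℕ → ℕ → ℝ} (g : ℕ → ℕ → ℝ) (gIR : ℝ)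
    (hγ : 0 < γ) (hb : 0 < b) (hθ0 : 0 ≤ θ) (hθ1 : θ < 1) (hc : 0 ≤ c) (hC : 0 ≤ C) (hM' : 0 < M')
    (hrun : ∀ K, RGEqH K β (g K)) (hbox : ∀ K i, i ≤ K → 0 < g K i ∧ g K i ≤ γ) (hpin : ∀ K, g K K = gIR)
    (hS : ScaleShiftRate c θ γ β) (hL : HistLipschitz Λ γ β) (hF : FadingMemory C θ Λ)
    (hcolM : ∀ i N, ∑ l ∈ Ico i N, Λ l i ≤ M') (hlo : EventualLowerH b γ k₀ β)
    (hsmall : 4 * (M' * (((k₀ : ℝ) + 1) * γ ^ 3 + 2 * γ / b)) < 1) :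
    ContinuumRunning β g gIR γ b := by
  obtain ⟨κ, _, hκ1, hinj⟩ :=
    injectedRate_of_fading_col g gIR hγ hb hθ0 hθ1 hc hC hM' hrun hbox hpin hS hL hF hcolM hlo hsmall
  exact continuumRunning_of_injectedRate hκ1 hinj hrun hbox hpin hlo hb.le

end Summit.QuantumFields.BalabanUV.Beta.EriceRemainderEnclosureHistoryFadingColumn

end
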